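import Summits.Ventures.HSemireg.WedgeHankelClassMapMatrix

/-!
# Venture HSemireg — THE CLASS MAP ON THE SUB-BOX CLASSES HAS THE HANKEL MATRIX'S LEFT KERNEL: with the binomials `C(k,r)` units in `K`, **`H_k(q)` has full row rank `k + 1` iff NO
# non-zero class `w_k(c)` of the first `k` pairs kills `w_N(q)`**, and a rank deficiency produces such a class explicitly (M8's matrix identity read both ways)

HONEST FRAMING. Part of the Lean index of the computation cell `pub-hsemireg` (seat p10 gen 24, Sunday typer «UNIFORM-IN-n»).
Finite-dimensional EXTERIOR ALGEBRA over a field + linear algebra of the catalecticant ONLY: no variety, no cohomology theory, no sheaf, no Ext group, no semiregularity map;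
nothing here says that HC / HC_CM / HC_AV holds; no Literature fact is declared or used.  Custodian versions as in `WedgeHankelSiegelIdeal` (1/3); dictionary QUOTED, never asserted.

WHAT IS IN THE TREE.  M8 (this seat, `WedgeHankelClassMapMatrix`): `w_mul_w_top_eq_zero_iff_vecMul_hankel1` (`w_k(c) ∧ w_N(q) = 0 ↔ (r ↦ (−1)^r C(k,r) c_{k−r}) ᵥ* H_k(q) = 0`);
Mathlib: `Matrix.vecMul_injective_iff` (injective iff the rows are independent), `Matrix.rank_eq_finrank_span_row`, `linearIndependent_iff_card_eq_finrank_span`.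
THIS FILE (namespace `Summit.Ventures.HSemireg.Wedge.HankelOuter` continued; imports M8):
* §418 `vecMul_hankel1_injective_iff` (`v ↦ v ᵥ* H_k(q)` is injective iff `rank H_k(q) = k + 1`), **`forall_coeff_eq_zero_of_w_mul_w_eq_zero`** (`k ≤ N`, all `C(k,r) ≠ 0` in `K`, `rank H_k(q) =
  k + 1`: `w_k(c) ∧ w_N(q) = 0 ⇒ c_j = 0` for all `j ≤ k` — only the zero sub-box class kills a class of full Hankel rank), **`exists_w_mul_w_eq_zero_of_rank_le`** (`rank H_k(q) ≤ k` ⇒ an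
  explicit non-zero window `c` with `w_k(c) ∧ w_N(q) = 0`: untwist a non-zero left-kernel vector), and the criterion **`rank_hankel1_eq_succ_iff_forall_w_mul_w`**.
READING: per `k`-set of pairs the class map's kernel on the `k + 1` sub-box classes is the left kernel of the catalecticant (M8); here the two extreme readings used by the atlas
(«full rank ⇔ kernel = Siegel piece» of gen 11/L8, now on the class side).  Nothing Ext-side.  New names only.
-/

open Module

namespace Summit.Ventures.HSemireg.Wedge.HankelOuter

open Summit.Ventures.HSemireg.Wedge Summit.Ventures.HSemireg.Wedge.Kunneth Summit.Ventures.HSemireg.Wedge.Hankel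
  Summit.Ventures.HSemireg.Wedge.BasisFree Summit.Ventures.HSemireg.Wedge.HankelSiegel Summit.Ventures.HSemireg.Wedge.HankelSiegelIdeal
  Summit.Ventures.HSemireg.Wedge.KunnethKernel Summit.Ventures.HSemireg.Wedge.HankelFrameChange Summit.Ventures.HSemireg.Wedge.KernelDuality

variable (K : Type*) [Field K] {N : ℕ}

/-! ## §418. Full row rank iff only the zero sub-box class kills -/

/-- `v ↦ v ᵥ* H_k(q)` is injective iff `H_k(q)` has full row rank `k + 1` (rows independent). -/
theorem vecMul_hankel1_injective_iff (k : ℕ) (q : ℕ → K) :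
    Function.Injective (hankel1 K N k q).vecMul ↔ (hankel1 K N k q).rank = k + 1 := by
  rw [Matrix.vecMul_injective_iff, linearIndependent_iff_card_eq_finrank_span, Fintype.card_fin, Set.finrank, ← Matrix.rank_eq_finrank_span_row]
  exact eq_comm

/-- **FULL HANKEL RANK ⇒ ONLY THE ZERO SUB-BOX CLASS KILLS: if `k ≤ N`, every `C(k,r)` (`r ≤ k`) is non-zero in `K` and `rank H_k(q) = k + 1`, then `w_k(c) ∧ w_N(q) = 0` forces
`c_j = 0` for all `j ≤ k`.** -/
theorem forall_coeff_eq_zero_of_w_mul_w_eq_zero {k : ℕ} (hk : k ≤ N) (hK : ∀ r ≤ k, (k.choose r : K) ≠ 0) {q : ℕ → K} (hr : (hankel1 K N k q).rank = k + 1)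
    {c : ℕ → K} (h : w K N k c * w K N N q = 0) : ∀ j ≤ k, c j = 0 := by
  rw [w_mul_w_top_eq_zero_iff_vecMul_hankel1 K hk] at h
  have hinj := (vecMul_hankel1_injective_iff K (N := N) k q).mpr hr
  have hv : (fun r : Fin (k + 1) => (-1) ^ (r : ℕ) * (k.choose (r : ℕ) : K) * c (k - (r : ℕ))) = 0 :=
    hinj (show Matrix.vecMul _ (hankel1 K N k q) = Matrix.vecMul 0 (hankel1 K N k q) by rw [h, Matrix.zero_vecMul])
  intro j hj
  have hvj := congr_fun hv ⟨k - j, by omega⟩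
  simp only [Pi.zero_apply, mul_eq_zero, pow_eq_zero_iff', neg_eq_zero, one_ne_zero, ne_eq, false_and, false_or] at hvj
  rcases hvj with h0 | h0
  · exact absurd h0 (hK (k - j) (Nat.sub_le k j))
  · rwa [Nat.sub_sub_self hj] at h0

/-- **RANK DEFICIENCY ⇒ A NON-ZERO KILLING SUB-BOX CLASS: if `k ≤ N`, every `C(k,r)` is non-zero in `K` and `rank H_k(q) ≤ k`, there is a window `c` with some `c_j ≠ 0` (`j ≤ k`) and
`w_k(c) ∧ w_N(q) = 0`** — untwist a non-zero vector of the left kernel: `c_{k−r} = v_r / ((−1)^r C(k,r))`. -/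
theorem exists_w_mul_w_eq_zero_of_rank_le {k : ℕ} (hk : k ≤ N) (hK : ∀ r ≤ k, (k.choose r : K) ≠ 0) {q : ℕ → K} (hr : (hankel1 K N k q).rank ≤ k) :
    ∃ c : ℕ → K, (∃ j ≤ k, c j ≠ 0) ∧ w K N k c * w K N N q = 0 := by
  have hni : ¬ Function.Injective (hankel1 K N k q).vecMul := by
    rw [vecMul_hankel1_injective_iff]
    omega
  have hni' : ¬ Function.Injective (hankel1 K N k q).vecMulLinear := by rwa [Matrix.coe_vecMulLinear]
  rw [injective_iff_map_eq_zero] at hni'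
  push Not at hni'
  obtain ⟨v, hv0, hvne⟩ := hni'
  have hv0' : Matrix.vecMul v (hankel1 K N k q) = 0 := by rwa [Matrix.coe_vecMulLinear] at hv0
  obtain ⟨r₀, hr₀⟩ := Function.ne_iff.mp hvne
  let c : ℕ → K := fun j => if j ≤ k then v ⟨k - j, by omega⟩ / ((-1) ^ (k - j) * (k.choose (k - j) : K)) else 0
  have hc : (fun r : Fin (k + 1) => (-1) ^ (r : ℕ) * (k.choose (r : ℕ) : K) * c (k - (r : ℕ))) = v := by
    funext r
    have hr' := r.2
    have e1 : k - (k - (r : ℕ)) = r := Nat.sub_sub_self (by omega)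
    have hC : (k.choose (r : ℕ) : K) ≠ 0 := hK r (by omega)
    have hne : ((-1 : K) ^ (r : ℕ) * (k.choose (r : ℕ) : K)) ≠ 0 := mul_ne_zero (pow_ne_zero _ (neg_ne_zero.mpr one_ne_zero)) hC
    simp only [c, if_pos (Nat.sub_le k (r : ℕ)), e1, Fin.eta]
    field_simp
  refine ⟨c, ⟨k - (r₀ : ℕ), Nat.sub_le _ _, ?_⟩, ?_⟩
  · have e := congr_fun hc r₀
    intro h0
    rw [h0, mul_zero] at e
    exact hr₀ e.symm
  · rw [w_mul_w_top_eq_zero_iff_vecMul_hankel1 K hk, hc, hv0']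

/-- **THE CRITERION ON THE CLASS SIDE: `rank H_k(q) = k + 1 ↔ ∀ c, w_k(c) ∧ w_N(q) = 0 → ∀ j ≤ k, c_j = 0`** (`k ≤ N`, all `C(k,r) ≠ 0` in `K`). -/
theorem rank_hankel1_eq_succ_iff_forall_w_mul_w {k : ℕ} (hk : k ≤ N) (hK : ∀ r ≤ k, (k.choose r : K) ≠ 0) (q : ℕ → K) :
    (hankel1 K N k q).rank = k + 1 ↔ ∀ c : ℕ → K, w K N k c * w K N N q = 0 → ∀ j ≤ k, c j = 0 := by
  constructor
  · intro hr c h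
    exact forall_coeff_eq_zero_of_w_mul_w_eq_zero K hk hK hr h
  · intro h
    by_contra hne
    have hle : (hankel1 K N k q).rank ≤ k := by
      have := le_trans (Matrix.rank_le_card_height (hankel1 K N k q)) (le_of_eq (Fintype.card_fin _))
      omega
    obtain ⟨c, ⟨j, hj, hcj⟩, h0⟩ := exists_w_mul_w_eq_zero_of_rank_le K hk hK hle
    exact hcj (h c h0 j hj)

end Summit.Ventures.HSemireg.Wedge.HankelOuter
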